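import Mathlib
import Literature.AlgebraicGeometry.Resolution.CobordantGame
import Literature.AlgebraicGeometry.Resolution.CobordantChartCoefficients
import Literature.AlgebraicGeometry.Resolution.CobordantTupleGame
import Literature.AlgebraicGeometry.Resolution.FormalCoordinateChange

/-!
# `WeightedInvariant.LocalWeightedDrop`, line `hasse-ridge-face-selection`, sub-stub N4″: the DESCENT GAME on monic double points (definitions + rank extraction)

Crux item stmt-ResolutionOfSingularities-8899 `LocalWeightedDrop` (route `ResolutionOfSingularities/WeightedInvariant`), door
`WeightedConstruction` stmt-ResolutionOfSingularities-0571.  [OURS · L1 W4.3, chain w43, lead prover.  Objects the engine line posits;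
not a statement of any manuscript.]

The registered sub-stub N4″ `stub_monicDoublePointFormalRank` (skeleton v21) asks for ONE ordinal rank `κ` on the pairs
`(A₀, A₁) ∈ k̄[[x]]²` with the formal step property of `monicDoublePointsWon_of_reducedFormalRank`.  Such an `∃ κ` statement is a
WELL-FOUNDEDNESS statement about a positional game — the DESCENT GAME: positions `y² + A₁y + A₀` (`ord A₀ ≥ 3`, `ord A₁ ≥ 2`); the
rank player re-presents the position formally, re-centres, and blows up the point or a permissible curve `V(x_i, y)`; the opponent
answers with a singular slice, which is either hyperbolic (exit) or re-presented as a new position; double planes `(r², 2r)` are exits.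
This file fixes that game as DEFINITIONS, literally in the syntax of the stub, and proves the RANK EXTRACTION: the stub follows from
"every reduced position is in the attractor `Descends`" (the ordinal-staged winning region, defined by well-founded recursion exactly
as `CobordantGame.WonBy`), with `κ :=` the least stage.  The termination theorem (every reduced position descends — Cossart–Jannsen–Saito
Ch. 11–13 for `J = (f)`, `e = 2`, `k = k̄`, in label form) is thereby decoupled from the game syntax.

* `pos A₀ A₁` — the germ `y² + A₁y + A₀` (`y = X (Fin.last _)`); `IsPosition`, `IsDoublePlane` (`(A₀, A₁) = (r², 2r)`);
* `IsHyperbolic S` — the hyperbolic-quadric exit witness (hypothesis shape of `TangentConeCut.hyperbolicStartsWon`);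
* `Represents S B₀ B₁` — `θ^* S = H · pos B` for a formal coordinate change `θ` (zero constant terms, invertible linear part), `H(0) ≠ 0`;
* `PointClause B₀ B₁ φ good`, `CurveClause B₀ B₁ φ good` — the two move clauses of the stub, verbatim, with the goodness predicate abstracted;
* `DescendsBy α A₀ A₁` — stage-`α` membership in the attractor; `Descends` = some stage;
* `formalStep_of_descends` — RANK EXTRACTION: if every reduced position over every algebraically closed field of characteristic `2`
  descends, then N4″ holds VERBATIM (the registered signature), with `κ A := sInf {α | DescendsBy α A}`.
-/

set_option linter.dupNamespace false -- mandated namespace of this single-conjunct summit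

namespace Summit.ResolutionOfSingularities.ResolutionOfSingularities.Theorems

open Literature.AlgebraicGeometry.Resolution

namespace MonicDescent

variable {k : Type} [Field k] {n : ℕ}

/-- The germ `y² + A₁ y + A₀ ∈ k[[x₁,…,x_{m}, y]]` of a pair (`y` the last variable). -/
noncomputable def pos {m : ℕ} (A₀ A₁ : MvPowerSeries (Fin m) k) : MvPowerSeries (Fin (m + 1)) k :=
  MvPowerSeries.X (Fin.last m) ^ 2 +
    (MvPowerSeries.rename (Fin.succAboveEmb (Fin.last m)) A₀ +
      MvPowerSeries.rename (Fin.succAboveEmb (Fin.last m)) A₁ * MvPowerSeries.X (Fin.last m))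

/-- A POSITION of the descent game: `ord A₀ ≥ 3`, `ord A₁ ≥ 2` (tangent cone `y²`). -/
def IsPosition {m : ℕ} (A₀ A₁ : MvPowerSeries (Fin m) k) : Prop :=
  (2 : ℕ∞) < A₀.order ∧ (1 : ℕ∞) < A₁.order

/-- A DOUBLE PLANE `(y + r)² = y² + 2ry + r²`: the non-reduced positions, exits of the game (won outright by the divisor move). -/
def IsDoublePlane {m : ℕ} (A₀ A₁ : MvPowerSeries (Fin m) k) : Prop :=
  ∃ r : MvPowerSeries (Fin m) k, A₁ = 2 * r ∧ A₀ = r ^ 2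

/-- The HYPERBOLIC EXIT: after a formal coordinate change the quadratic part of `S` contains `X₀X₁` and neither `X₀²` nor `X₁²`
(hypothesis shape of `TangentConeCut.hyperbolicStartsWon`; in the game these successors have `e ≤ 1`). -/
def IsHyperbolic (S : MvPowerSeries (Fin (n + 3)) k) : Prop :=
  ∃ θ : Fin (n + 3) → MvPowerSeries (Fin (n + 3)) k, (∀ i, MvPowerSeries.constantCoeff (θ i) = 0) ∧
    IsUnit (Matrix.det (Matrix.of fun i j => MvPowerSeries.coeff (Finsupp.single j 1) (θ i))) ∧
    MvPowerSeries.coeff (Finsupp.single 0 2) (MvPowerSeries.subst θ S) = 0 ∧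
    MvPowerSeries.coeff (Finsupp.single 1 2) (MvPowerSeries.subst θ S) = 0 ∧
    MvPowerSeries.coeff (Finsupp.single 0 1 + Finsupp.single 1 1) (MvPowerSeries.subst θ S) ≠ 0

/-- `S` is FORMALLY RE-PRESENTED by the pair `B`: `θ^* S = H · pos B` for a substitution `θ` with zero constant terms and invertible
linear part and a unit `H`.  (`Won` is invariant under both: `won_subst_iff`, `won_unit_mul_iff`.) -/
def Represents (S : MvPowerSeries (Fin (n + 3)) k) (B₀ B₁ : MvPowerSeries (Fin (n + 2)) k) : Prop :=
  ∃ (θ : Fin (n + 3) → MvPowerSeries (Fin (n + 3)) k) (H : MvPowerSeries (Fin (n + 3)) k),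
    (∀ i, MvPowerSeries.constantCoeff (θ i) = 0) ∧ IsUnit (FormalCoordChange.linMat θ).det ∧
    MvPowerSeries.constantCoeff H ≠ 0 ∧ MvPowerSeries.subst θ S = H * pos B₀ B₁

/-- The POINT-MOVE clause of the stub (verbatim): every singular slice of the point blow-up of the re-centred position
`(B₀ + B₁φ + φ², B₁ + 2φ)` — slices spelled as in `won_monic_of_pointBlowup` — is `good`. -/
def PointClause (B₀ B₁ φ : MvPowerSeries (Fin (n + 2)) k) (good : MvPowerSeries (Fin (n + 3)) k → Prop) : Prop :=
  ∀ (c : Fin (n + 2) → k) (i₀ : Fin (n + 2)), c i₀ ≠ 0 → ∀ Bv : Fin 2 → MvPowerSeries (Fin (n + 3)) k,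
    (∀ j : Fin 2, MvPowerSeries.subst (CobordantChart.chart (fun _ : Fin (n + 2) => 1) c)
      ((![B₀ + B₁ * φ + φ ^ 2, B₁ + 2 * φ] : Fin 2 → MvPowerSeries (Fin (n + 2)) k) j) =
      MvPowerSeries.X 0 ^ (2 - (j : ℕ) + 1) * Bv j) →
    ∀ S : MvPowerSeries (Fin (n + 3)) k, S = MvPowerSeries.X (Fin.last (n + 2)) ^ 2 +
      ∑ j : Fin 2, MvPowerSeries.rename (Fin.succAboveEmb (Fin.last (n + 2)))
        (TupleGame.slice i₀ (MvPowerSeries.X 0 * Bv j)) * MvPowerSeries.X (Fin.last (n + 2)) ^ (j : ℕ) →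
    CobordantGame.IsSingular k S → good S

/-- The CURVE-MOVE clause of the stub (verbatim): for some permissible `V(x_i, y)` (divisibility data `A'`), every singular slice of the
curve blow-up — slices spelled as in `won_monic_of_curveBlowup` — is `good`. -/
def CurveClause (B₀ B₁ φ : MvPowerSeries (Fin (n + 2)) k) (good : MvPowerSeries (Fin (n + 3)) k → Prop) : Prop :=
  ∃ (i : Fin (n + 2)) (A' : Fin 2 → MvPowerSeries (Fin (n + 2)) k),
    (∀ j : Fin 2, ((![B₀ + B₁ * φ + φ ^ 2, B₁ + 2 * φ] : Fin 2 → MvPowerSeries (Fin (n + 2)) k) j) =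
      MvPowerSeries.X i ^ (2 - (j : ℕ)) * A' j) ∧
    (∀ j : Fin 2, MvPowerSeries.constantCoeff (A' j) = 0) ∧
    ∀ ci : k, ci ≠ 0 → ∀ S : MvPowerSeries (Fin (n + 3)) k, S = MvPowerSeries.X (Fin.last (n + 2)) ^ 2 +
      ∑ j : Fin 2, MvPowerSeries.rename (Fin.succAboveEmb (Fin.last (n + 2)))
        (MvPowerSeries.C (ci ^ (2 - (j : ℕ))) * TupleGame.slice i
          (MvPowerSeries.subst (CobordantChart.chart (fun l : Fin (n + 2) => if l = i then 1 else 0)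
            (fun l : Fin (n + 2) => if l = i then ci else 0)) (A' j))) *
        MvPowerSeries.X (Fin.last (n + 2)) ^ (j : ℕ) →
      CobordantGame.IsSingular k S → good S

/-- `PointClause` is monotone in the goodness predicate. -/
theorem PointClause.mono {B₀ B₁ φ : MvPowerSeries (Fin (n + 2)) k} {good good' : MvPowerSeries (Fin (n + 3)) k → Prop}
    (hle : ∀ S, good S → good' S) (h : PointClause B₀ B₁ φ good) : PointClause B₀ B₁ φ good' :=
  fun c i₀ hc Bv hBv S hS hsing => hle S (h c i₀ hc Bv hBv S hS hsing)

/-- `CurveClause` is monotone in the goodness predicate. -/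
theorem CurveClause.mono {B₀ B₁ φ : MvPowerSeries (Fin (n + 2)) k} {good good' : MvPowerSeries (Fin (n + 3)) k → Prop}
    (hle : ∀ S, good S → good' S) (h : CurveClause B₀ B₁ φ good) : CurveClause B₀ B₁ φ good' := by
  obtain ⟨i, A', hdiv, h0, hS⟩ := h
  exact ⟨i, A', hdiv, h0, fun ci hci S hSe hsing => hle S (hS ci hci S hSe hsing)⟩

/-- STAGE-`α` MEMBERSHIP IN THE ATTRACTOR of the descent game (well-founded recursion on the ordinal, as `CobordantGame.WonBy`):
`(A₀, A₁)` descends by stage `α` if it is a double plane, or the rank player has a formal re-presentation `B`, a re-centring `φ`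
and a move (point / permissible curve) all of whose singular slices are hyperbolic or re-presented by positions descending by a
stage `< α`. -/
def DescendsBy : Ordinal.{0} → MvPowerSeries (Fin (n + 2)) k → MvPowerSeries (Fin (n + 2)) k → Prop
  | α, A₀, A₁ => IsDoublePlane A₀ A₁ ∨
      ∃ B₀ B₁ : MvPowerSeries (Fin (n + 2)) k, IsPosition B₀ B₁ ∧ Represents (pos A₀ A₁) B₀ B₁ ∧
        ∃ φ : MvPowerSeries (Fin (n + 2)) k, MvPowerSeries.constantCoeff φ = 0 ∧
          IsPosition (B₀ + B₁ * φ + φ ^ 2) (B₁ + 2 * φ) ∧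
          (PointClause B₀ B₁ φ (fun S => IsHyperbolic S ∨ ∃ A₀' A₁' : MvPowerSeries (Fin (n + 2)) k,
              IsPosition A₀' A₁' ∧ Represents S A₀' A₁' ∧ ∃ (β : Ordinal.{0}) (_ : β < α), DescendsBy β A₀' A₁') ∨
           CurveClause B₀ B₁ φ (fun S => IsHyperbolic S ∨ ∃ A₀' A₁' : MvPowerSeries (Fin (n + 2)) k,
              IsPosition A₀' A₁' ∧ Represents S A₀' A₁' ∧ ∃ (β : Ordinal.{0}) (_ : β < α), DescendsBy β A₀' A₁'))
  termination_by α => α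

/-- THE ATTRACTOR of the descent game: descends by some stage. -/
def Descends (A₀ A₁ : MvPowerSeries (Fin (n + 2)) k) : Prop := ∃ α, DescendsBy α A₀ A₁

/-- Unfolding of `DescendsBy`. -/
theorem descendsBy_iff (α : Ordinal.{0}) (A₀ A₁ : MvPowerSeries (Fin (n + 2)) k) :
    DescendsBy α A₀ A₁ ↔ IsDoublePlane A₀ A₁ ∨
      ∃ B₀ B₁ : MvPowerSeries (Fin (n + 2)) k, IsPosition B₀ B₁ ∧ Represents (pos A₀ A₁) B₀ B₁ ∧
        ∃ φ : MvPowerSeries (Fin (n + 2)) k, MvPowerSeries.constantCoeff φ = 0 ∧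
          IsPosition (B₀ + B₁ * φ + φ ^ 2) (B₁ + 2 * φ) ∧
          (PointClause B₀ B₁ φ (fun S => IsHyperbolic S ∨ ∃ A₀' A₁' : MvPowerSeries (Fin (n + 2)) k,
              IsPosition A₀' A₁' ∧ Represents S A₀' A₁' ∧ ∃ (β : Ordinal.{0}) (_ : β < α), DescendsBy β A₀' A₁') ∨
           CurveClause B₀ B₁ φ (fun S => IsHyperbolic S ∨ ∃ A₀' A₁' : MvPowerSeries (Fin (n + 2)) k,
              IsPosition A₀' A₁' ∧ Represents S A₀' A₁' ∧ ∃ (β : Ordinal.{0}) (_ : β < α), DescendsBy β A₀' A₁')) := by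
  rw [DescendsBy]

/-- Stages are upward closed. -/
theorem DescendsBy.mono {α α' : Ordinal.{0}} (hle : α ≤ α') {A₀ A₁ : MvPowerSeries (Fin (n + 2)) k}
    (h : DescendsBy α A₀ A₁) : DescendsBy α' A₀ A₁ := by
  rw [descendsBy_iff] at h ⊢
  rcases h with hpl | ⟨B₀, B₁, hB, hrep, φ, hφ, hBφ, hmv⟩
  · exact Or.inl hpl
  · refine Or.inr ⟨B₀, B₁, hB, hrep, φ, hφ, hBφ, ?_⟩
    have hgood : ∀ S, (IsHyperbolic S ∨ ∃ A₀' A₁' : MvPowerSeries (Fin (n + 2)) k,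
        IsPosition A₀' A₁' ∧ Represents S A₀' A₁' ∧ ∃ (β : Ordinal.{0}) (_ : β < α), DescendsBy β A₀' A₁') →
        (IsHyperbolic S ∨ ∃ A₀' A₁' : MvPowerSeries (Fin (n + 2)) k,
        IsPosition A₀' A₁' ∧ Represents S A₀' A₁' ∧ ∃ (β : Ordinal.{0}) (_ : β < α'), DescendsBy β A₀' A₁') := by
      rintro S (hh | ⟨A₀', A₁', hA', hrepS, β, hβ, hd⟩)
      · exact Or.inl hh
      · exact Or.inr ⟨A₀', A₁', hA', hrepS, β, lt_of_lt_of_le hβ hle, hd⟩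
    rcases hmv with hp | hc
    · exact Or.inl (hp.mono hgood)
    · exact Or.inr (hc.mono hgood)

/-- The LEAST STAGE of a pair (`0` if it does not descend). -/
noncomputable def stage (A₀ A₁ : MvPowerSeries (Fin (n + 2)) k) : Ordinal.{0} :=
  sInf {α | DescendsBy α A₀ A₁}

/-- A descending pair descends by its least stage. -/
theorem descendsBy_stage {A₀ A₁ : MvPowerSeries (Fin (n + 2)) k} (h : Descends A₀ A₁) :
    DescendsBy (stage A₀ A₁) A₀ A₁ :=
  csInf_mem h

/-- The least stage is below every stage. -/
theorem stage_le {α : Ordinal.{0}} {A₀ A₁ : MvPowerSeries (Fin (n + 2)) k} (h : DescendsBy α A₀ A₁) :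
    stage A₀ A₁ ≤ α :=
  csInf_le' h

end MonicDescent

open MonicDescent in
/-- RANK EXTRACTION (OURS · L1 W4.3): if, over every algebraically closed field of characteristic `2`, every REDUCED position
(`ord A₀ ≥ 3`, `ord A₁ ≥ 2`, not a double plane) of the descent game descends (`MonicDescent.Descends`), then the registered
sub-stub N4″ `stub_monicDoublePointFormalRank` of skeleton v21 holds VERBATIM, with the rank `κ := MonicDescent.stage` (least
stage).  Unfolding plus `csInf_mem`; the step property is the stage-`κ A` unfolding with every `∃ β < κ A` turned into
`κ A′ ≤ β < κ A`. -/
theorem formalStep_of_descends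
    (hdesc : ∀ (k : Type) [Field k] [CharP k 2] [IsAlgClosed k] (A₀ A₁ : MvPowerSeries (Fin 2) k),
      MonicDescent.IsPosition A₀ A₁ → ¬ MonicDescent.IsDoublePlane A₀ A₁ → MonicDescent.Descends A₀ A₁) :
    ∀ (k : Type) [Field k] [CharP k 2] [IsAlgClosed k],
    ∃ κ : MvPowerSeries (Fin 2) k → MvPowerSeries (Fin 2) k → Ordinal.{0},
    ∀ A₀ A₁ : MvPowerSeries (Fin 2) k, (2 : ℕ∞) < A₀.order → (1 : ℕ∞) < A₁.order →
    (¬ ∃ r : MvPowerSeries (Fin 2) k, A₁ = 2 * r ∧ A₀ = r ^ 2) →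
    ∃ (θ₀ : Fin 3 → MvPowerSeries (Fin 3) k) (H₀ : MvPowerSeries (Fin 3) k) (B₀ B₁ : MvPowerSeries (Fin 2) k),
      (∀ i, MvPowerSeries.constantCoeff (θ₀ i) = 0) ∧ IsUnit (FormalCoordChange.linMat θ₀).det ∧
      MvPowerSeries.constantCoeff H₀ ≠ 0 ∧ (2 : ℕ∞) < B₀.order ∧ (1 : ℕ∞) < B₁.order ∧
      MvPowerSeries.subst θ₀ (MvPowerSeries.X (Fin.last 2) ^ 2 +
          (MvPowerSeries.rename (Fin.succAboveEmb (Fin.last 2)) A₀ +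
            MvPowerSeries.rename (Fin.succAboveEmb (Fin.last 2)) A₁ * MvPowerSeries.X (Fin.last 2))) =
        H₀ * (MvPowerSeries.X (Fin.last 2) ^ 2 +
          (MvPowerSeries.rename (Fin.succAboveEmb (Fin.last 2)) B₀ +
            MvPowerSeries.rename (Fin.succAboveEmb (Fin.last 2)) B₁ * MvPowerSeries.X (Fin.last 2))) ∧
    ∃ φ : MvPowerSeries (Fin 2) k, MvPowerSeries.constantCoeff φ = 0 ∧
      (2 : ℕ∞) < (B₀ + B₁ * φ + φ ^ 2).order ∧ (1 : ℕ∞) < (B₁ + 2 * φ).order ∧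
      let good : MvPowerSeries (Fin 3) k → Prop := fun S =>
        (∃ θ : Fin 3 → MvPowerSeries (Fin 3) k, (∀ i, MvPowerSeries.constantCoeff (θ i) = 0) ∧
          IsUnit (Matrix.det (Matrix.of fun i j => MvPowerSeries.coeff (Finsupp.single j 1) (θ i))) ∧
          MvPowerSeries.coeff (Finsupp.single 0 2) (MvPowerSeries.subst θ S) = 0 ∧
          MvPowerSeries.coeff (Finsupp.single 1 2) (MvPowerSeries.subst θ S) = 0 ∧
          MvPowerSeries.coeff (Finsupp.single 0 1 + Finsupp.single 1 1) (MvPowerSeries.subst θ S) ≠ 0) ∨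
        (∃ (θ : Fin 3 → MvPowerSeries (Fin 3) k) (H : MvPowerSeries (Fin 3) k) (A₀' A₁' : MvPowerSeries (Fin 2) k),
          (∀ i, MvPowerSeries.constantCoeff (θ i) = 0) ∧ IsUnit (FormalCoordChange.linMat θ).det ∧
          MvPowerSeries.constantCoeff H ≠ 0 ∧ (2 : ℕ∞) < A₀'.order ∧ (1 : ℕ∞) < A₁'.order ∧
          MvPowerSeries.subst θ S =
            H * (MvPowerSeries.X (Fin.last 2) ^ 2 +
              (MvPowerSeries.rename (Fin.succAboveEmb (Fin.last 2)) A₀' +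
                MvPowerSeries.rename (Fin.succAboveEmb (Fin.last 2)) A₁' * MvPowerSeries.X (Fin.last 2))) ∧
          κ A₀' A₁' < κ A₀ A₁)
      ((∀ (c : Fin 2 → k) (i₀ : Fin 2), c i₀ ≠ 0 → ∀ Bv : Fin 2 → MvPowerSeries (Fin 3) k,
          (∀ j : Fin 2, MvPowerSeries.subst (CobordantChart.chart (fun _ : Fin 2 => 1) c)
            ((![B₀ + B₁ * φ + φ ^ 2, B₁ + 2 * φ] : Fin 2 → MvPowerSeries (Fin 2) k) j) =
            MvPowerSeries.X 0 ^ (2 - (j : ℕ) + 1) * Bv j) →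
          ∀ S : MvPowerSeries (Fin 3) k, S = MvPowerSeries.X (Fin.last 2) ^ 2 +
            ∑ j : Fin 2, MvPowerSeries.rename (Fin.succAboveEmb (Fin.last 2))
              (TupleGame.slice i₀ (MvPowerSeries.X 0 * Bv j)) * MvPowerSeries.X (Fin.last 2) ^ (j : ℕ) →
          CobordantGame.IsSingular k S → good S) ∨
       (∃ (i : Fin 2) (A' : Fin 2 → MvPowerSeries (Fin 2) k),
          (∀ j : Fin 2, ((![B₀ + B₁ * φ + φ ^ 2, B₁ + 2 * φ] : Fin 2 → MvPowerSeries (Fin 2) k) j) =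
            MvPowerSeries.X i ^ (2 - (j : ℕ)) * A' j) ∧
          (∀ j : Fin 2, MvPowerSeries.constantCoeff (A' j) = 0) ∧
          ∀ ci : k, ci ≠ 0 → ∀ S : MvPowerSeries (Fin 3) k, S = MvPowerSeries.X (Fin.last 2) ^ 2 +
            ∑ j : Fin 2, MvPowerSeries.rename (Fin.succAboveEmb (Fin.last 2))
              (MvPowerSeries.C (ci ^ (2 - (j : ℕ))) * TupleGame.slice i
                (MvPowerSeries.subst (CobordantChart.chart (fun l : Fin 2 => if l = i then 1 else 0)
                  (fun l : Fin 2 => if l = i then ci else 0)) (A' j))) *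
              MvPowerSeries.X (Fin.last 2) ^ (j : ℕ) →
            CobordantGame.IsSingular k S → good S)) := by
  intro k _ _ _
  refine ⟨fun A₀ A₁ => stage A₀ A₁, fun A₀ A₁ hA₀ hA₁ hred => ?_⟩
  have hD : Descends A₀ A₁ := hdesc k A₀ A₁ ⟨hA₀, hA₁⟩ hred
  have hst := descendsBy_stage hD
  rw [descendsBy_iff] at hst
  rcases hst with hpl | ⟨B₀, B₁, ⟨hB₀, hB₁⟩, ⟨θ₀, H₀, hθ₀0, hθ₀det, hH₀, hre⟩, φ, hφ, ⟨hC₀, hC₁⟩, hmv⟩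
  · exact absurd hpl hred
  refine ⟨θ₀, H₀, B₀, B₁, hθ₀0, hθ₀det, hH₀, hB₀, hB₁, hre, φ, hφ, hC₀, hC₁, ?_⟩
  -- translate the goodness predicate: `∃ β < stage A, DescendsBy β A'` gives `stage A' ≤ β < stage A`
  have hgood : ∀ S : MvPowerSeries (Fin 3) k, (IsHyperbolic S ∨ ∃ A₀' A₁' : MvPowerSeries (Fin 2) k,
      IsPosition A₀' A₁' ∧ Represents S A₀' A₁' ∧ ∃ (β : Ordinal.{0}) (_ : β < stage A₀ A₁), DescendsBy β A₀' A₁') →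
      ((∃ θ : Fin 3 → MvPowerSeries (Fin 3) k, (∀ i, MvPowerSeries.constantCoeff (θ i) = 0) ∧
          IsUnit (Matrix.det (Matrix.of fun i j => MvPowerSeries.coeff (Finsupp.single j 1) (θ i))) ∧
          MvPowerSeries.coeff (Finsupp.single 0 2) (MvPowerSeries.subst θ S) = 0 ∧
          MvPowerSeries.coeff (Finsupp.single 1 2) (MvPowerSeries.subst θ S) = 0 ∧
          MvPowerSeries.coeff (Finsupp.single 0 1 + Finsupp.single 1 1) (MvPowerSeries.subst θ S) ≠ 0) ∨
        (∃ (θ : Fin 3 → MvPowerSeries (Fin 3) k) (H : MvPowerSeries (Fin 3) k) (A₀' A₁' : MvPowerSeries (Fin 2) k),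
          (∀ i, MvPowerSeries.constantCoeff (θ i) = 0) ∧ IsUnit (FormalCoordChange.linMat θ).det ∧
          MvPowerSeries.constantCoeff H ≠ 0 ∧ (2 : ℕ∞) < A₀'.order ∧ (1 : ℕ∞) < A₁'.order ∧
          MvPowerSeries.subst θ S = H * (MvPowerSeries.X (Fin.last 2) ^ 2 +
              (MvPowerSeries.rename (Fin.succAboveEmb (Fin.last 2)) A₀' +
                MvPowerSeries.rename (Fin.succAboveEmb (Fin.last 2)) A₁' * MvPowerSeries.X (Fin.last 2))) ∧
          stage A₀' A₁' < stage A₀ A₁)) := by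
    rintro S (hh | ⟨A₀', A₁', ⟨hA₀', hA₁'⟩, ⟨θ, H, hθ0, hθdet, hH, hSeq⟩, β, hβ, hd⟩)
    · exact Or.inl hh
    · exact Or.inr ⟨θ, H, A₀', A₁', hθ0, hθdet, hH, hA₀', hA₁', hSeq, lt_of_le_of_lt (stage_le hd) hβ⟩
  rcases hmv with hp | ⟨i, A', hdiv, hA'0, hc⟩
  · exact Or.inl fun c i₀ hci Bv hBv S hS hsing => hgood S (hp c i₀ hci Bv hBv S hS hsing)
  · exact Or.inr ⟨i, A', hdiv, hA'0, fun ci hci S hS hsing => hgood S (hc ci hci S hS hsing)⟩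

end Summit.ResolutionOfSingularities.ResolutionOfSingularities.Theorems
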